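import Summits.CriticalPhenomena.CardyFormulaZ2.Theorems.CardyUniqueLimitCardyRigiditySlitDuality
import Literature.Probability.Percolation.PlanarDuality
import HarnessLib

/-!
# Slit duality, IIIa: winding numbers of closed lattice walks across the sides of a face

Crux `Summit.CriticalPhenomena.CardyFormulaZ2.Theses.CardyUniqueLimit.CardyRigidity`
(stmt-CriticalPhenomena-0746), line `crossing_martingale`, stub `stub_slitObservableApprox`
(THE HEART), piece (P-approx) "exact slit duality": the winding-number toolkit for the
disjointness half (`…SlitDuality3.lean`), in the face vocabulary of `…SlitDuality.lean`
(`faceSide`, `faceNbr`) on top of `walkWinding` of `PlanarDuality.lean` (Kesten 1982, §2.2):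
for a CLOSED lattice walk the winding number does not change across a side it does not use
(`walkWinding_faceNbr_eq`; the boundary terms of `walkWinding_sub_walkWinding_up` cancel), changes
across a side it uses exactly once (`walkWinding_faceNbr_ne`), and vanishes on every non-inner face
of Dobrushin data whose non-inner faces escape to infinity across non-edges of `Ω_δ` when the walk
consists of edges of `Ω_δ` (`walkWinding_eq_zero_of_not_isInnerFace`); plus the dictionary between
the face of a coded corner and its source/target sides (`cFace_faceSide`).
-/

noncomputable section

open MeasureTheory Set
open Literature.Probability Literature.Probability.LatticeModels Literature.Probability.Percolation
open Literature.Probability.LatticeModels.DiscreteDobrushin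

namespace Summit.CriticalPhenomena.CardyFormulaZ2.Cruxes.CardyRigidity.CrossingMartingale

namespace EventIdentity

section Winding

variable {D : DiscreteDobrushin}

/-! ### Sides and neighbours of a face in coordinates -/

/-- The four sides of a face in coordinates. [folklore] -/
theorem faceSide_cases (f : Site 2) :
    faceSide f 0 = s(f - (Pi.single 1 1 : Site 2) + (Pi.single 1 1 : Site 2),
        f - (Pi.single 1 1 : Site 2) + (Pi.single 1 1 : Site 2) + (Pi.single 0 1 : Site 2)) ∧
      faceSide f 1 = s(f + (Pi.single 0 1 : Site 2), f + (Pi.single 0 1 : Site 2) + (Pi.single 1 1 : Site 2)) ∧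
      faceSide f 2 = s(f + (Pi.single 1 1 : Site 2), f + (Pi.single 1 1 : Site 2) + (Pi.single 0 1 : Site 2)) ∧
      faceSide f 3 = s(f - (Pi.single 0 1 : Site 2) + (Pi.single 0 1 : Site 2),
        f - (Pi.single 0 1 : Site 2) + (Pi.single 0 1 : Site 2) + (Pi.single 1 1 : Site 2)) := by
  simp only [faceSide_eq, sub_add_cancel]
  refine ⟨?_, ?_, ?_, ?_⟩
  · simp [cornerOff]
  · simp [cornerOff, add_assoc]
  · rw [Sym2.eq_swap]; simp [cornerOff]; abel_nf
  · rw [Sym2.eq_swap]; simp [cornerOff]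

/-- The four neighbours of a face in coordinates. [folklore] -/
theorem faceNbr_cases (f : Site 2) :
    faceNbr f 0 = f - (Pi.single 1 1 : Site 2) ∧ faceNbr f 1 = f + (Pi.single 0 1 : Site 2) ∧
      faceNbr f 2 = f + (Pi.single 1 1 : Site 2) ∧ faceNbr f 3 = f - (Pi.single 0 1 : Site 2) := by
  simp only [faceNbr_eq]
  refine ⟨?_, ?_, ?_, ?_⟩
  · simp [cornerOff]
  · simp [cornerOff]
  · simp [cornerOff]; abel
  · simp [cornerOff]

/-! ### Winding numbers of closed lattice walks across the sides of a face -/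

variable {x : Site 2}

/-- Across a horizontal edge not used by a CLOSED walk the winding number does not change (the
boundary terms of `walkWinding_sub_walkWinding_up` cancel). [cite: KestenPTM1982, §2.2] -/
theorem walkWinding_eq_walkWinding_up_closed (p : (zdGraph 2).Walk x x) {u : Site 2}
    (h : s(u + (Pi.single 1 1 : Site 2), u + (Pi.single 1 1 : Site 2) + (Pi.single 0 1 : Site 2)) ∉ p.edges) :
    walkWinding p u = walkWinding p (u + (Pi.single 1 1 : Site 2)) := by
  have hsum : (p.darts.map fun d ↦ hCross u d.fst d.snd).sum = 0 := by
    refine List.sum_eq_zero fun t ht ↦ ?_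
    obtain ⟨d, hd, rfl⟩ := List.mem_map.1 ht
    refine hCross_eq_zero_of_ne fun heq ↦ h ?_
    rw [← heq]
    exact List.mem_map.2 ⟨d, hd, rfl⟩
  have := walkWinding_sub_walkWinding_up p u
  rw [hsum, sub_self] at this
  linarith

/-- **No jump**: across a side of a face not used by a closed lattice walk, the winding number
does not change. [cite: KestenPTM1982, §2.2] -/
theorem walkWinding_faceNbr_eq (p : (zdGraph 2).Walk x x) {f : Site 2} :
    ∀ {j : Fin 4}, faceSide f j ∉ p.edges → walkWinding p (faceNbr f j) = walkWinding p f := by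
  obtain ⟨h0, h1, h2, h3⟩ := faceSide_cases f
  obtain ⟨n0, n1, n2, n3⟩ := faceNbr_cases f
  intro j
  obtain rfl | rfl | rfl | rfl : j = 0 ∨ j = 1 ∨ j = 2 ∨ j = 3 := by revert j; decide
  all_goals intro h
  · rw [h0] at h; rw [n0]
    have := walkWinding_eq_walkWinding_up_closed p h
    rwa [sub_add_cancel] at this
  · rw [h1] at h; rw [n1]
    exact (walkWinding_eq_walkWinding_right h).symm
  · rw [h2] at h; rw [n2]
    exact (walkWinding_eq_walkWinding_up_closed p h).symm
  · rw [h3] at h; rw [n3]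
    have := walkWinding_eq_walkWinding_right h
    rwa [sub_add_cancel] at this

/-- A signed sum over a list that is `0` off one value taken exactly once and `±1` there is `±1`.
[folklore] -/
theorem sum_map_eq_of_count_eq_one {α : Type*} [DecidableEq α] {β : Type*} (l : List β) (k : β → α)
    (g : β → ℤ) (a : α) (hcount : (l.map k).count a = 1) (hz : ∀ b ∈ l, k b ≠ a → g b = 0)
    (hpm : ∀ b ∈ l, k b = a → g b = 1 ∨ g b = -1) : (l.map g).sum = 1 ∨ (l.map g).sum = -1 := by
  induction l with
  | nil => simp at hcount
  | cons b l ih =>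
    rw [List.map_cons, List.count_cons] at hcount
    rw [List.map_cons, List.sum_cons]
    split_ifs at hcount with hba
    · have hb : k b = a := by simpa using hba
      have hl : (l.map k).count a = 0 := by omega
      have hzero : (l.map g).sum = 0 := by
        refine List.sum_eq_zero fun t ht ↦ ?_
        obtain ⟨b', hb', rfl⟩ := List.mem_map.1 ht
        refine hz b' (List.mem_cons_of_mem _ hb') fun h' ↦ ?_
        exact (List.count_eq_zero.1 hl) (List.mem_map.2 ⟨b', hb', h'⟩)
      rw [hzero, add_zero]
      exact hpm b List.mem_cons_self hb
    · have hb : k b ≠ a := by simpa using hba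
      have hl : (l.map k).count a = 1 := by omega
      rw [hz b List.mem_cons_self hb, zero_add]
      exact ih hl (fun b' hb' ↦ hz b' (List.mem_cons_of_mem _ hb'))
        (fun b' hb' ↦ hpm b' (List.mem_cons_of_mem _ hb'))

/-- Jump across a vertical edge used exactly once. [cite: KestenPTM1982, §2.2] -/
theorem walkWinding_ne_right_of_count {a b : Site 2} (p : (zdGraph 2).Walk a b) {u : Site 2}
    (h : p.edges.count s(u + (Pi.single 0 1 : Site 2), u + (Pi.single 0 1 : Site 2) + (Pi.single 1 1 : Site 2)) = 1) :
    walkWinding p u ≠ walkWinding p (u + (Pi.single 0 1 : Site 2)) := by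
  have hd := walkWinding_sub_walkWinding_right p u
  have key := sum_map_eq_of_count_eq_one p.darts SimpleGraph.Dart.edge (fun d ↦ vCross u d.fst d.snd)
    s(u + (Pi.single 0 1 : Site 2), u + (Pi.single 0 1 : Site 2) + (Pi.single 1 1 : Site 2)) h (fun d _ hne ↦ vCross_eq_zero_of_ne hne) (fun d _ heq ↦ by
      have heq' : s(d.fst, d.snd) = s(u + (Pi.single 0 1 : Site 2), u + (Pi.single 0 1 : Site 2) + (Pi.single 1 1 : Site 2)) := heq
      rcases Sym2.eq_iff.1 heq' with ⟨h1, h2⟩ | ⟨h1, h2⟩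
      · left; unfold vCross; rw [h1, h2]; simp
      · right; unfold vCross; rw [h1, h2]; simp)
  intro heq
  rw [heq, sub_self] at hd
  rcases key with k | k <;> rw [k] at hd <;> norm_num at hd

/-- Jump across a horizontal edge used exactly once by a closed walk. [cite: KestenPTM1982, §2.2] -/
theorem walkWinding_ne_up_of_count (p : (zdGraph 2).Walk x x) {u : Site 2}
    (h : p.edges.count s(u + (Pi.single 1 1 : Site 2), u + (Pi.single 1 1 : Site 2) + (Pi.single 0 1 : Site 2)) = 1) :
    walkWinding p u ≠ walkWinding p (u + (Pi.single 1 1 : Site 2)) := by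
  have hd := walkWinding_sub_walkWinding_up p u
  rw [sub_self, neg_zero, zero_sub] at hd
  have key := sum_map_eq_of_count_eq_one p.darts SimpleGraph.Dart.edge (fun d ↦ hCross u d.fst d.snd)
    s(u + (Pi.single 1 1 : Site 2), u + (Pi.single 1 1 : Site 2) + (Pi.single 0 1 : Site 2)) h (fun d _ hne ↦ hCross_eq_zero_of_ne hne) (fun d _ heq ↦ by
      have heq' : s(d.fst, d.snd) = s(u + (Pi.single 1 1 : Site 2), u + (Pi.single 1 1 : Site 2) + (Pi.single 0 1 : Site 2)) := heq
      rcases Sym2.eq_iff.1 heq' with ⟨h1, h2⟩ | ⟨h1, h2⟩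
      · left; unfold hCross; rw [h1, h2]; simp
      · right; unfold hCross; rw [h1, h2]; simp)
  intro heq
  rw [heq, sub_self] at hd
  rcases key with k | k <;> rw [k] at hd <;> norm_num at hd

/-- **Jump**: across a side of a face used exactly once by a closed lattice walk, the winding
number changes. [cite: KestenPTM1982, §2.2] -/
theorem walkWinding_faceNbr_ne (p : (zdGraph 2).Walk x x) {f : Site 2} :
    ∀ {j : Fin 4}, p.edges.count (faceSide f j) = 1 → walkWinding p (faceNbr f j) ≠ walkWinding p f := by
  obtain ⟨h0, h1, h2, h3⟩ := faceSide_cases f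
  obtain ⟨n0, n1, n2, n3⟩ := faceNbr_cases f
  intro j
  obtain rfl | rfl | rfl | rfl : j = 0 ∨ j = 1 ∨ j = 2 ∨ j = 3 := by revert j; decide
  all_goals intro h
  · rw [h0] at h; rw [n0]
    have := walkWinding_ne_up_of_count p h
    rwa [sub_add_cancel] at this
  · rw [h1] at h; rw [n1]
    exact (walkWinding_ne_right_of_count p h).symm
  · rw [h2] at h; rw [n2]
    exact (walkWinding_ne_up_of_count p h).symm
  · rw [h3] at h; rw [n3]
    have := walkWinding_ne_right_of_count p h
    rwa [sub_add_cancel] at this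

/-- **Escape**: if every non-inner face is joined to faces of arbitrary height by steps across
non-edges of `Ω_δ`, a closed walk of edges of `Ω_δ` does not wind around non-inner faces.
[cite: KestenPTM1982, §2.2] -/
theorem walkWinding_eq_zero_of_not_isInnerFace
    (hesc : ∀ g : Site 2, ¬ D.IsInnerFace g → ∀ M : ℤ, ∃ g' : Site 2, M ≤ g' 1 ∧
      Relation.ReflTransGen (fun f f' : Site 2 ↦ ∃ j : Fin 4, faceNbr f j = f' ∧
        faceSide f j ∉ (discreteDomainGraph D.Ω D.δ).edgeSet) g g')
    (p : (zdGraph 2).Walk x x) (hp : ∀ e ∈ p.edges, e ∈ (discreteDomainGraph D.Ω D.δ).edgeSet)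
    {g : Site 2} (hg : ¬ D.IsInnerFace g) : walkWinding p g = 0 := by
  obtain ⟨N, hN⟩ := Finset.exists_le (p.support.toFinset.image fun z : Site 2 ↦ z 1)
  have hN' : ∀ z ∈ p.support, z 1 ≤ N := fun z hz ↦
    hN _ (Finset.mem_image.2 ⟨z, List.mem_toFinset.2 hz, rfl⟩)
  obtain ⟨g', hg', hchain⟩ := hesc g hg N
  have hconst : ∀ f f' : Site 2, Relation.ReflTransGen (fun f f' : Site 2 ↦ ∃ j : Fin 4, faceNbr f j = f' ∧
      faceSide f j ∉ (discreteDomainGraph D.Ω D.δ).edgeSet) f f' → walkWinding p f = walkWinding p f' := by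
    intro f f' h
    induction h with
    | refl => rfl
    | tail _ hst ih =>
      obtain ⟨j, rfl, hj⟩ := hst
      rw [ih, walkWinding_faceNbr_eq p fun he ↦ hj (hp _ he)]
  rw [hconst g g' hchain]
  exact walkWinding_eq_zero_of_le hN' hg'

/-! ### Faces around the exploration -/

/-- The face of a coded corner `(v, k)`: its `k`-th corner is `v`, its `k`-th side is the source
edge, its `(k+3)`-rd side is the target edge, across which lies the next face around `v`.
[cite: Smirnov2001, §2] -/
theorem cFace_faceSide (p : Site 2 × Fin 4) :
    cFace p + cornerOff p.2 = p.1 ∧ faceSide (cFace p) p.2 = cSrc p ∧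
      faceNbr (cFace p) p.2 = faceAt p.1 (p.2 + 3) ∧ faceSide (cFace p) (p.2 + 3) = cTgt p ∧
      faceNbr (cFace p) (p.2 + 3) = faceAt p.1 (p.2 + 1) := by
  obtain ⟨v, k⟩ := p
  have h4 : k + 3 + 1 = k := by rw [add_right_comm, fin4_add_one_add_three]
  have h6 : ∀ k : Fin 4, k + 3 + 3 = k + 2 := by decide
  have hv : cFace (v, k) + cornerOff k = v := by simp [cFace, faceAt]
  refine ⟨hv, by rw [faceSide, hv], by rw [faceNbr, hv], ?_, ?_⟩
  · rw [faceSide_eq, cTgt, Sym2.eq_swap]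
    simp only [cFace, faceAt]
    rw [h4, sub_add_cancel, cornerUnit_succ_eq]
    congr 1; abel
  · rw [faceNbr_eq]
    simp only [cFace, faceAt]
    have hk : cornerOff k - cornerOff (k + 3) + cornerOff (k + 2) = cornerOff (k + 1) := cornerOff_sub_add k
    rw [h6 k]
    have : v - cornerOff k + cornerOff (k + 3) - cornerOff (k + 2) =
        v - (cornerOff k - cornerOff (k + 3) + cornerOff (k + 2)) := by abel
    rw [this, hk]

end Winding

end EventIdentity

/-- **Registered form** (anchor `slitDuality_walkWinding_faceNbr_ne` of stmt-CriticalPhenomena-0746): across a side of a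
face used exactly once by a closed lattice walk, the winding number of the walk changes (the discrete Jordan-curve jump).
[cite: KestenPTM1982, §2.2] -/
theorem slitDuality_walkWinding_faceNbr_ne : ∀ {x : Literature.Probability.LatticeModels.Site 2} (p : (Literature.Probability.LatticeModels.zdGraph 2).Walk x x) (f : Literature.Probability.LatticeModels.Site 2) (j : Fin 4), p.edges.count (EventIdentity.faceSide f j) = 1 → Literature.Probability.Percolation.walkWinding p (EventIdentity.faceNbr f j) ≠ Literature.Probability.Percolation.walkWinding p f :=
  fun p _ _ h ↦ EventIdentity.walkWinding_faceNbr_ne p h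

end Summit.CriticalPhenomena.CardyFormulaZ2.Cruxes.CardyRigidity.CrossingMartingale

end
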